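import Literature.Topology.FourManifolds.EntranceTransitionMaps

/-!
# The orientation law for the planar transition maps of the entrance charts

Topic `Literature/Topology/FourManifolds` (support of `stmt-SmoothPoincare4-15190`, structure
conjugacy).  Everything here is **proved**.  Conclusion of the chain `FrameCharacterParam` →
`BasinConeParam` → `EntranceSheetLaw` → `SphereConeJacobian` → `EntranceTransitionMaps`:

* `BasinCouple.SaddleData.det_fderiv_tPlanar_pos_iff` — for couple saddle data on an *oriented*
  compact `3`-manifold with boundary (boxes of index `1`, equal bottom and saddle values), a
  saddle `s` and a diffeomorphism `φ` of `S²` mapping the unit core directions of `s` to those of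
  `σ s`, **the Jacobians at `0` of the two planar transition maps `tPlanar φ s true`,
  `tPlanar φ s false` have determinants of the same sign.**

Steps: the differential of the spatial transition `piMap` at the entrance vector preserves the
hyperplane `{u₀ = 0}` acting there as `d(tPlanar)₀` (germ identity) and preserves the coordinate
`u₀` (it preserves Milnor's quadratic form), so `det d(piMap) = det d(tPlanar)₀` by the block
determinant of `BoundaryOrientation.lean`; and `det d(piMap)` is the product of the Jacobians
of `coord_B ∘ coneParam_B`, of the cone of `φ` and of `transition_A`, whose signs at the two
ends agree by `EntranceSheetLaw.lean` (for `A` and for `B`) and `coneJac_pos_iff`.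

## References

* J. Milnor, *Lectures on the h-cobordism theorem* (1965), proof of Thm. 3.12/3.13.
  [MilnorHCobordism1965]
* M. W. Hirsch, *Differential Topology* (1976), Ch. 4 §4. [HirschDT1976]
-/

open scoped Manifold ContDiff Topology
open Set Function Filter Metric Module

noncomputable section

namespace Literature.Topology.FourManifolds

open Cobordism FourManifolds.Flow TracePolar

universe u

/-! ### One datum: the transition and its local inverse -/

namespace BasinPair.SaddleData

variable {W : Type u} [TopologicalSpace W] [T2Space W] [SecondCountableTopology W]
  [CompactSpace W] [ChartedSpace (EuclideanHalfSpace (2 + 1)) W] [IsManifold (𝓡∂ (2 + 1)) ∞ W]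
  {g : W → ℝ} {ξA ξB : Π x : W, TangentSpace (𝓡∂ (2 + 1)) x} {P : BasinPair g ξA ξB} (Q : P.SaddleData)

/-- Local notation for the model plane and space. -/
local notation "E2" => EuclideanSpace ℝ (Fin 2)
local notation "E3" => EuclideanSpace ℝ (Fin 3)

variable {s : SaddlePt 2 g} (hk : (Q.DA s).k = 1)
include hk

/-- **The transition is smooth at the entrance vectors.** [folklore] -/
theorem contDiffAt_transition (b : Bool) : ContDiffAt ℝ ∞ (Q.transition s) (entPoint Q.ε b 0) := by
  obtain ⟨h1, h2, h3⟩ := Q.entW_zero_mem_basin hk b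
  have hpt := Q.contMDiffAt_pt (s := s) (Q.norm_entPoint_zero_lt b)
  have hinv : ContMDiffAt (𝓡∂ (2 + 1)) 𝓘(ℝ, E3) ∞ P.A.coneInv ((Q.DA s).pt (entPoint Q.ε b 0)) := P.A.contMDiffAt_coneInv h1 h2 h3
  exact (hinv.comp _ hpt).contDiffAt

/-- **The transition value at the entrance vector lies in the cone domain, and `coneParam` of it is
the entrance point.** [folklore] -/
theorem transition_entPoint_zero_mem (b : Bool) :
    Q.transition s (entPoint Q.ε b 0) ∈ P.A.coneDom ∧ P.A.coneParam (Q.transition s (entPoint Q.ε b 0)) = Q.entW s b 0 := by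
  obtain ⟨h1, h2, h3⟩ := Q.entW_zero_mem_basin hk b
  exact ⟨P.A.coneInv_mem_coneDom h1 h2 h3, P.A.coneParam_coneInv h1 h2 h3⟩

/-- **The local inverse `coord ∘ coneParam` of the transition is smooth at the transition value.** [folklore] -/
theorem contDiffAt_coord_coneParam (b : Bool) :
    ContDiffAt ℝ ∞ ((Q.DA s).coord ∘ P.A.coneParam) (Q.transition s (entPoint Q.ε b 0)) := by
  obtain ⟨hdom, hval⟩ := Q.transition_entPoint_zero_mem hk b
  have hpar := P.A.contMDiffAt_coneParam hdom
  have hco : ContMDiffAt (𝓡∂ (2 + 1)) 𝓘(ℝ, E3) ∞ (Q.DA s).coord (P.A.coneParam (Q.transition s (entPoint Q.ε b 0))) := by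
    rw [hval]; exact Q.contMDiffAt_coord ((Q.DA s).pt_mem_source_of_norm_le (by rw [Q.εA]; exact (Q.norm_entPoint_zero_lt b).le))
  exact (hco.comp _ hpar).contDiffAt

/-- **`(coord ∘ coneParam) ∘ transition = id` near the entrance vector.** [folklore] -/
theorem coord_coneParam_transition_eventuallyEq (b : Bool) :
    (((Q.DA s).coord ∘ P.A.coneParam) ∘ Q.transition s) =ᶠ[𝓝 (entPoint Q.ε b 0)] id := by
  filter_upwards [Q.eventually_pt_mem_basin hk b, Q.coord_pt_eventuallyEq (s := s) (Q.norm_entPoint_zero_lt b)] with u hu hu'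
  show (Q.DA s).coord (P.A.coneParam (P.A.coneInv ((Q.DA s).pt u))) = u
  rw [P.A.coneParam_coneInv hu.1 hu.2.1 hu.2.2]; exact hu'

/-- **The Jacobians of the transition and of its local inverse multiply to `1`.** [folklore] -/
theorem det_fderiv_coord_coneParam_mul (b : Bool) :
    LinearMap.det ((fderiv ℝ ((Q.DA s).coord ∘ P.A.coneParam) (Q.transition s (entPoint Q.ε b 0)) : E3 →L[ℝ] E3) : E3 →ₗ[ℝ] E3) *
      LinearMap.det ((fderiv ℝ (Q.transition s) (entPoint Q.ε b 0) : E3 →L[ℝ] E3) : E3 →ₗ[ℝ] E3) = 1 := by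
  have h1 := ((Q.contDiffAt_coord_coneParam hk b).differentiableAt (by simp)).hasFDerivAt
  have h2 := ((Q.contDiffAt_transition hk b).differentiableAt (by simp)).hasFDerivAt
  have hcomp := h1.comp _ h2
  have hid := (hcomp.congr_of_eventuallyEq (Q.coord_coneParam_transition_eventuallyEq hk b).symm).unique (hasFDerivAt_id _)
  have h3 := congrArg (fun T : E3 →L[ℝ] E3 => LinearMap.det (T : E3 →ₗ[ℝ] E3)) hid
  simp only [ContinuousLinearMap.coe_id, LinearMap.det_id] at h3
  rw [← h3]
  exact (LinearMap.det_comp _ _).symm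

omit hk in
/-- The transition Jacobian as `mfderiv` is the `fderiv`. [folklore] -/
theorem det_mfderiv_transition_eq (b : Bool) :
    LinearMap.det (M := E3) (mfderiv 𝓘(ℝ, E3) 𝓘(ℝ, E3) (Q.transition s) (entPoint Q.ε b 0)).toLinearMap =
      LinearMap.det ((fderiv ℝ (Q.transition s) (entPoint Q.ε b 0) : E3 →L[ℝ] E3) : E3 →ₗ[ℝ] E3) := by
  rw [mfderiv_eq_fderiv]
  rfl

/-- **The orientation law of `EntranceSheetLaw.lean` in terms of `fderiv`.** [cite: HirschDT1976, Ch. 4 §4 (after Lemma 4.1)] -/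
theorem det_fderiv_transition_pos_iff (o : SmoothOrientation (𝓡∂ (2 + 1)) W) :
    (0 < LinearMap.det ((fderiv ℝ (Q.transition s) (entPoint Q.ε true 0) : E3 →L[ℝ] E3) : E3 →ₗ[ℝ] E3)) ↔
      (0 < LinearMap.det ((fderiv ℝ (Q.transition s) (entPoint Q.ε false 0) : E3 →L[ℝ] E3) : E3 →ₗ[ℝ] E3)) := by
  have h := Q.det_transition_pos_iff (s := s) hk o
  rw [Q.det_mfderiv_transition_eq, Q.det_mfderiv_transition_eq] at h
  exact h

end BasinPair.SaddleData

/-- **Sign bookkeeping** for the planar orientation law: `t = k · j · a` at both ends, `k · b = 1`,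
and `a`, `b`, `j` have end-independent signs. [folklore] -/
theorem pos_iff_pos_of_products {tT tF kT kF jT jF aT aF bT bF : ℝ} (htT : tT = kT * jT * aT) (htF : tF = kF * jF * aF)
    (hkbT : kT * bT = 1) (hkbF : kF * bF = 1) (ha : 0 < aT ↔ 0 < aF) (hb : 0 < bT ↔ 0 < bF) (hj : 0 < jT ↔ 0 < jF)
    (haT : aT ≠ 0) (haF : aF ≠ 0) (hjT : jT ≠ 0) (hjF : jF ≠ 0) : 0 < tT ↔ 0 < tF := by
  have hkT : kT ≠ 0 := fun h => by rw [h, zero_mul] at hkbT; exact zero_ne_one hkbT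
  have hkF : kF ≠ 0 := fun h => by rw [h, zero_mul] at hkbF; exact zero_ne_one hkbF
  have hbT0 : bT ≠ 0 := fun h => by rw [h, mul_zero] at hkbT; exact zero_ne_one hkbT
  have hbF0 : bF ≠ 0 := fun h => by rw [h, mul_zero] at hkbF; exact zero_ne_one hkbF
  have hkbT' : 0 < kT ↔ 0 < bT := by
    have h := mul_pos_iff_pos_iff_pos hkT hbT0; rw [hkbT] at h; exact h.1 one_pos
  have hkbF' : 0 < kF ↔ 0 < bF := by
    have h := mul_pos_iff_pos_iff_pos hkF hbF0; rw [hkbF] at h; exact h.1 one_pos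
  have hsT : 0 < tT ↔ ((0 < kT ↔ 0 < jT) ↔ 0 < aT) := by
    rw [htT, mul_pos_iff_pos_iff_pos (mul_ne_zero hkT hjT) haT, mul_pos_iff_pos_iff_pos hkT hjT]
  have hsF : 0 < tF ↔ ((0 < kF ↔ 0 < jF) ↔ 0 < aF) := by
    rw [htF, mul_pos_iff_pos_iff_pos (mul_ne_zero hkF hjF) haF, mul_pos_iff_pos_iff_pos hkF hjF]
  rw [hsT, hsF, hkbT', hkbF', ha, hb, hj]

/-- Determinant of a composition of continuous linear endomorphisms of `ℝ³`. [folklore] -/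
theorem det_coe_comp_three (A B : EuclideanSpace ℝ (Fin 3) →L[ℝ] EuclideanSpace ℝ (Fin 3)) :
    LinearMap.det ((A.comp B : EuclideanSpace ℝ (Fin 3) →L[ℝ] EuclideanSpace ℝ (Fin 3)) :
        EuclideanSpace ℝ (Fin 3) →ₗ[ℝ] EuclideanSpace ℝ (Fin 3)) =
      LinearMap.det (A : EuclideanSpace ℝ (Fin 3) →ₗ[ℝ] EuclideanSpace ℝ (Fin 3)) *
        LinearMap.det (B : EuclideanSpace ℝ (Fin 3) →ₗ[ℝ] EuclideanSpace ℝ (Fin 3)) := by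
  show LinearMap.det ((A : EuclideanSpace ℝ (Fin 3) →ₗ[ℝ] EuclideanSpace ℝ (Fin 3)).comp
    (B : EuclideanSpace ℝ (Fin 3) →ₗ[ℝ] EuclideanSpace ℝ (Fin 3))) = _
  exact LinearMap.det_comp _ _

/-! ### The couple: the law for the planar transitions -/

namespace BasinCouple.SaddleData

attribute [local instance] fact_finrank_euclideanSpace_succ

variable {W : Type u} [TopologicalSpace W] [T2Space W] [SecondCountableTopology W]
  [CompactSpace W] [ChartedSpace (EuclideanHalfSpace (2 + 1)) W] [IsManifold (𝓡∂ (2 + 1)) ∞ W]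
  {gA gB : W → ℝ} {ξA ξB : Π x : W, TangentSpace (𝓡∂ (2 + 1)) x} {C : BasinCouple gA gB ξA ξB}
  {Q : C.SaddleData} {s : SaddlePt 2 gA} (hkA : ∀ s, (Q.QA.DA s).k = 1) (hkB : ∀ s', (Q.QB.DA s').k = 1)
  (h₀ : gB C.B.p₀ = gA C.A.p₀) (hc : Q.QB.c = Q.QA.c)
  {φ : Metric.sphere (0 : EuclideanSpace ℝ (Fin 3)) 1 ≃ₘ⟮𝓡 2, 𝓡 2⟯ Metric.sphere (0 : EuclideanSpace ℝ (Fin 3)) 1}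
  (hφ0 : ∀ b, (φ (unitVec (Q.QA.coreDir s b)) : EuclideanSpace ℝ (Fin 3)) = C.A.rad⁻¹ • Q.QB.coreDir (Q.σ s) b)

/-- Local notation for the model plane and space. -/
local notation "E2" => EuclideanSpace ℝ (Fin 2)
local notation "E3" => EuclideanSpace ℝ (Fin 3)

/-- `‖0‖² < ε²` for `A`. [folklore] -/
theorem hy0A : ‖(0 : E2)‖ ^ 2 < Q.QA.ε ^ 2 := by rw [norm_zero]; simpa using Q.QA.sq_pos

/-- `‖0‖² < ε²` for `B`. [folklore] -/
theorem hy0B : ‖(0 : E2)‖ ^ 2 < Q.QB.ε ^ 2 := by rw [norm_zero]; simpa using Q.QB.sq_pos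

include hkA hkB h₀ hc hφ0 in
/-- **The cone of `φ` maps the `A`-transition value of the entrance vector to the `B`-transition
value of the entrance vector of `σ s`.** [folklore] -/
theorem sphereCone_transition_zero (b : Bool) :
    sphereCone φ (Q.QA.transition s (entPoint Q.QA.ε b 0)) = Q.QB.transition (Q.σ s) (entPoint Q.QB.ε b 0) := by
  rw [Q.sphereCone_transition_entPoint hkA hy0A, Q.coneU_zero hφ0]
  have hB := Q.swap.transition_entPoint (s := Q.σ s) (b := b) hkB (hy0B (Q := Q))
  rw [swap_QA] at hB
  change Q.QB.transition (Q.σ s) (entPoint Q.QB.ε b 0) = ((Q.QB.c - Q.QB.ε ^ 2 - gB C.B.p₀) / C.B.rad) • Q.QB.entDir (Q.σ s) b 0 at hB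
  rw [hB, hc, Q.ε_eq, h₀, C.rad_eq]
  rfl

include hkA hkB h₀ hc hφ0 in
/-- **`piMap` fixes the entrance vector.** [folklore] -/
theorem piMap_entPoint_zero (b : Bool) : Q.piMap φ s (entPoint Q.QA.ε b 0) = entPoint Q.QA.ε b 0 := by
  have h := (Q.piMap_entPoint_eventuallyEq hkA hkB h₀ hc hφ0 b).self_of_nhds
  simp only [comp_apply] at h
  rw [h, Q.tb_zero hkB hφ0]

include hkA hkB h₀ hc hφ0 in
/-- **`piMap` is smooth at the entrance vector.** [folklore] -/
theorem contDiffAt_piMap (b : Bool) : ContDiffAt ℝ ∞ (Q.piMap φ s) (entPoint Q.QA.ε b 0) := by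
  have h1 : ContDiffAt ℝ ∞ (Q.QA.transition s) (entPoint Q.QA.ε b 0) := Q.QA.contDiffAt_transition (hkA s) b
  have hne : Q.QA.transition s (entPoint Q.QA.ε b 0) ≠ 0 := (Q.QA.transition_entPoint_zero_mem (hkA s) b).1.1
  have h2 : ContDiffAt ℝ ∞ (sphereCone φ) (Q.QA.transition s (entPoint Q.QA.ε b 0)) := contDiffAt_sphereCone φ.contMDiff hne
  have h3 : ContDiffAt ℝ ∞ ((Q.QB.DA (Q.σ s)).coord ∘ C.B.coneParam) (sphereCone φ (Q.QA.transition s (entPoint Q.QA.ε b 0))) := by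
    rw [Q.sphereCone_transition_zero hkA hkB h₀ hc hφ0 b]
    exact Q.QB.contDiffAt_coord_coneParam (hkB _) b
  exact ContDiffAt.comp (g := (Q.QB.DA (Q.σ s)).coord ∘ C.B.coneParam) (f := fun u => sphereCone φ (Q.QA.transition s u))
    (entPoint Q.QA.ε b 0) h3 (h2.comp (entPoint Q.QA.ε b 0) h1)

include hkA hkB h₀ hc hφ0 in
/-- **The differential of `piMap` preserves the hyperplane `{u₀ = 0}`, acting as `d(tPlanar)₀`.** [cite: MilnorHCobordism1965, proof of Thm. 3.13] -/
theorem fderiv_piMap_comp_consZeroL (b : Bool) :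
    (fderiv ℝ (Q.piMap φ s) (entPoint Q.QA.ε b 0)).comp (consZeroL 2) = (consZeroL 2).comp (fderiv ℝ (Q.tPlanar φ s b) 0) := by
  have hpi := ((Q.contDiffAt_piMap hkA hkB h₀ hc hφ0 b).differentiableAt (by simp)).hasFDerivAt
  obtain ⟨hy, hmem⟩ := (Q.eventually_coneU_mem_entDom hkA hkB hφ0 b).self_of_nhds
  have htb := (((Q.contMDiffAt_tPlanar hkA b hy hmem).contDiffAt).differentiableAt (by simp)).hasFDerivAt
  have hent := hasFDerivAt_entPoint_zero Q.QA.ε_pos.ne' b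
  have hL : HasFDerivAt (Q.piMap φ s ∘ entPoint Q.QA.ε b) ((fderiv ℝ (Q.piMap φ s) (entPoint Q.QA.ε b 0)).comp (consZeroL 2)) 0 :=
    hpi.comp 0 hent
  have hent' : HasFDerivAt (entPoint Q.QA.ε b) (consZeroL 2) (Q.tPlanar φ s b 0) := by
    rw [Q.tb_zero hkB hφ0]; exact hent
  have hR : HasFDerivAt (entPoint Q.QA.ε b ∘ Q.tPlanar φ s b) ((consZeroL 2).comp (fderiv ℝ (Q.tPlanar φ s b) 0)) 0 :=
    hent'.comp 0 htb
  exact (hL.congr_of_eventuallyEq (Q.piMap_entPoint_eventuallyEq hkA hkB h₀ hc hφ0 b).symm).unique hR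
    |> fun h => h

include hkA hkB h₀ hc hφ0 in
/-- **`piMap` preserves Milnor's quadratic form near the entrance vector.** [cite: MilnorHCobordism1965, proof of Thm. 3.12] -/
theorem milnorQuadratic_piMap_eventuallyEq (b : Bool) :
    (fun u => milnorQuadratic 1 (Q.piMap φ s u)) =ᶠ[𝓝 (entPoint Q.QA.ε b 0)] milnorQuadratic 1 := by
  set u₀ : E3 := entPoint Q.QA.ε b 0 with hu₀
  -- continuity of the inner maps at `u₀`
  have h1c : ContinuousAt (Q.QA.transition s) u₀ := (Q.QA.contDiffAt_transition (hkA s) b).continuousAt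
  have hne : Q.QA.transition s u₀ ≠ 0 := (Q.QA.transition_entPoint_zero_mem (hkA s) b).1.1
  have h2c : ContinuousAt (fun u => sphereCone φ (Q.QA.transition s u)) u₀ :=
    (contDiffAt_sphereCone φ.contMDiff hne).continuousAt.comp h1c
  have hz : sphereCone φ (Q.QA.transition s u₀) = Q.QB.transition (Q.σ s) (entPoint Q.QB.ε b 0) :=
    Q.sphereCone_transition_zero hkA hkB h₀ hc hφ0 b
  obtain ⟨hzdom, hzval⟩ := Q.QB.transition_entPoint_zero_mem (hkB _) b (s := Q.σ s)
  have hzval' : C.B.coneParam (Q.QB.transition (Q.σ s) (entPoint Q.QB.ε b 0)) = Q.QB.entW (Q.σ s) b 0 := hzval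
  have hzdom' : Q.QB.transition (Q.σ s) (entPoint Q.QB.ε b 0) ∈ C.B.coneDom := hzdom
  have h3c : ContinuousAt (fun u => C.B.coneParam (sphereCone φ (Q.QA.transition s u))) u₀ := by
    refine ContinuousAt.comp (f := fun u => sphereCone φ (Q.QA.transition s u)) (g := C.B.coneParam) ?_ h2c
    rw [hz]; exact (C.B.contMDiffAt_coneParam hzdom').continuousAt
  -- eventual memberships
  have e1 : ∀ᶠ u in 𝓝 u₀, sphereCone φ (Q.QA.transition s u) ∈ C.B.coneDom :=
    h2c.preimage_mem_nhds (by rw [hz]; exact C.B.isOpen_coneDom.mem_nhds hzdom')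
  have e2 : ∀ᶠ u in 𝓝 u₀, C.B.coneParam (sphereCone φ (Q.QA.transition s u)) ∈ (Q.QB.DA (Q.σ s)).chartBall (3 * Q.QB.ε) := by
    refine h3c.preimage_mem_nhds ((Q.QB.DA (Q.σ s)).isOpen_chartBall.mem_nhds ?_)
    show C.B.coneParam (sphereCone φ (Q.QA.transition s u₀)) ∈ _
    rw [hz, hzval']
    exact (BasinPair.SaddleData.entW_mem_chartBall (Q := Q.QB) (hy0B (Q := Q))).1
  have e3 := Q.QA.eventually_pt_mem_basin (hkA s) b
  have e4 : ∀ᶠ u : E3 in 𝓝 u₀, ‖u‖ < 3 * Q.QA.ε :=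
    (isOpen_lt continuous_norm continuous_const).mem_nhds (Q.QA.norm_entPoint_zero_lt b)
  filter_upwards [e1, e2, e3, e4] with u hu1 hu2 hu3 hu4
  -- the computation
  set x := C.B.coneParam (sphereCone φ (Q.QA.transition s u)) with hx
  have hxs : ‖(Q.QB.DA (Q.σ s)).coord x‖ < 3 * Q.QB.ε := hu2.2
  have hlevB : gB x = gB C.B.p₀ + ‖sphereCone φ (Q.QA.transition s u)‖ := (C.B.coneParam_mem_basin hu1).2.2
  have hnormA : ‖Q.QA.transition s u‖ = gA ((Q.QA.DA s).pt u) - gA C.A.p₀ := by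
    rw [BasinPair.SaddleData.transition_def]; exact C.A.norm_coneInv hu3.1 hu3.2.1 hu3.2.2
  have hq : gB ((Q.QB.DA (Q.σ s)).pt (Q.piMap φ s u)) = Q.QB.c + milnorQuadratic 1 (Q.piMap φ s u) :=
    Q.QB.apply_pt (hkB _) hxs.le
  rw [piMap_apply, ← hx, (Q.QB.DA (Q.σ s)).pt_coord_of_mem_chartBall hu2] at hq
  have hqA : gA ((Q.QA.DA s).pt u) = Q.QA.c + milnorQuadratic 1 u := Q.QA.apply_pt (hkA s) hu4.le
  rw [piMap_apply, ← hx]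
  have : milnorQuadratic 1 ((Q.QB.DA (Q.σ s)).coord x) = gB x - Q.QB.c := by linarith
  rw [this, hlevB, norm_sphereCone, hnormA, hqA, h₀, hc]; ring

include hkA hkB h₀ hc hφ0 in
/-- **The differential of `piMap` preserves the first coordinate.** [cite: MilnorHCobordism1965, proof of Thm. 3.12] -/
theorem fderiv_piMap_apply_zero (b : Bool) (v : E3) : (fderiv ℝ (Q.piMap φ s) (entPoint Q.QA.ε b 0) v) 0 = v 0 := by
  set u₀ : E3 := entPoint Q.QA.ε b 0 with hu₀
  have hpi := ((Q.contDiffAt_piMap hkA hkB h₀ hc hφ0 b).differentiableAt (by simp)).hasFDerivAt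
  have hyv : yv u₀ = 0 := yv_entPoint _ _ _
  have hQ := hasFDerivAt_milnorQuadratic_one_of_yv_eq_zero hyv
  have hfix : Q.piMap φ s u₀ = u₀ := Q.piMap_entPoint_zero hkA hkB h₀ hc hφ0 b
  have hQ' : HasFDerivAt (milnorQuadratic 1 : E3 → ℝ) ((-2 * u₀ 0) • (EuclideanSpace.proj (0 : Fin 3) : E3 →L[ℝ] ℝ)) (Q.piMap φ s u₀) := by
    rw [hfix]; exact hQ
  have hcomp := hQ'.comp u₀ hpi
  have heq := (hcomp.congr_of_eventuallyEq (Q.milnorQuadratic_piMap_eventuallyEq hkA hkB h₀ hc hφ0 b).symm).unique hQ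
  have h := congrArg (fun T : E3 →L[ℝ] ℝ => T v) heq
  simp only [ContinuousLinearMap.comp_apply, FunLike.coe_smul, Pi.smul_apply, smul_eq_mul] at h
  have hu0 : u₀ 0 ≠ 0 := by
    rw [hu₀]
    show boolSign b * Real.sqrt (Q.QA.ε ^ 2 + ‖(0 : E2)‖ ^ 2) ≠ 0
    rw [norm_zero]; simp only [ne_eq, zero_pow, OfNat.ofNat_ne_zero, not_false_eq_true, add_zero, Real.sqrt_sq Q.QA.ε_pos.le]
    exact mul_ne_zero (by cases b <;> simp [boolSign]) Q.QA.ε_pos.ne'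
  have h2 : (-2 * u₀ 0) ≠ 0 := mul_ne_zero (by norm_num) hu0
  exact mul_left_cancel₀ h2 h

include hkA hkB h₀ hc hφ0 in
/-- **`det d(piMap) = det d(tPlanar)₀`** at the entrance vector (block determinant). [cite: HirschDT1976, Ch. 4 §4] -/
theorem det_fderiv_piMap (b : Bool) :
    LinearMap.det ((fderiv ℝ (Q.piMap φ s) (entPoint Q.QA.ε b 0) : E3 →L[ℝ] E3) : E3 →ₗ[ℝ] E3) =
      LinearMap.det ((fderiv ℝ (Q.tPlanar φ s b) 0 : E2 →L[ℝ] E2) : E2 →ₗ[ℝ] E2) := by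
  rw [det_eq_mul_det_of_comp_consZeroL _ _ (Q.fderiv_piMap_comp_consZeroL hkA hkB h₀ hc hφ0 b),
    Q.fderiv_piMap_apply_zero hkA hkB h₀ hc hφ0 b, e0_apply_zero, one_mul]

include hkA hkB h₀ hc hφ0 in
/-- **`det d(piMap)` is the product of the three Jacobians.** [folklore] -/
theorem det_fderiv_piMap_eq_mul (b : Bool) :
    LinearMap.det ((fderiv ℝ (Q.piMap φ s) (entPoint Q.QA.ε b 0) : E3 →L[ℝ] E3) : E3 →ₗ[ℝ] E3) =
      LinearMap.det ((fderiv ℝ ((Q.QB.DA (Q.σ s)).coord ∘ C.B.coneParam) (Q.QB.transition (Q.σ s) (entPoint Q.QB.ε b 0)) :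
          E3 →L[ℝ] E3) : E3 →ₗ[ℝ] E3) *
        coneJac φ (Q.QA.transition s (entPoint Q.QA.ε b 0)) *
        LinearMap.det ((fderiv ℝ (Q.QA.transition s) (entPoint Q.QA.ε b 0) : E3 →L[ℝ] E3) : E3 →ₗ[ℝ] E3) := by
  have h1 := ((Q.QA.contDiffAt_transition (hkA s) b).differentiableAt (by simp)).hasFDerivAt
  have hne : Q.QA.transition s (entPoint Q.QA.ε b 0) ≠ 0 := (Q.QA.transition_entPoint_zero_mem (hkA s) b).1.1
  have h2 := ((contDiffAt_sphereCone φ.contMDiff hne).differentiableAt (by simp)).hasFDerivAt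
  have h3 := ((Q.QB.contDiffAt_coord_coneParam (hkB _) b (s := Q.σ s)).differentiableAt (by simp)).hasFDerivAt
  rw [← Q.sphereCone_transition_zero hkA hkB h₀ hc hφ0 b] at h3
  have hcomp := h3.comp (entPoint Q.QA.ε b 0) (h2.comp (entPoint Q.QA.ε b 0) h1)
  have heq : fderiv ℝ (Q.piMap φ s) (entPoint Q.QA.ε b 0) = _ := hcomp.fderiv
  rw [heq, det_coe_comp_three, det_coe_comp_three, coneJac_def, Q.sphereCone_transition_zero hkA hkB h₀ hc hφ0 b, mul_assoc]
  rfl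

include hkA hkB h₀ hc hφ0 in
/-- **The orientation law for the planar transition maps**: for an oriented `W`, the Jacobian
determinants of `tPlanar φ s true` and `tPlanar φ s false` at `0` have the same sign. [cite: HirschDT1976, Ch. 4 §4] [cite: MilnorHCobordism1965, proof of Thm. 3.12/3.13] -/
theorem det_fderiv_tPlanar_pos_iff (o : SmoothOrientation (𝓡∂ (2 + 1)) W) :
    (0 < LinearMap.det ((fderiv ℝ (Q.tPlanar φ s true) 0 : E2 →L[ℝ] E2) : E2 →ₗ[ℝ] E2)) ↔
      (0 < LinearMap.det ((fderiv ℝ (Q.tPlanar φ s false) 0 : E2 →L[ℝ] E2) : E2 →ₗ[ℝ] E2)) := by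
  have hdet : ∀ b : Bool, LinearMap.det ((fderiv ℝ (Q.tPlanar φ s b) 0 : E2 →L[ℝ] E2) : E2 →ₗ[ℝ] E2) =
      LinearMap.det ((fderiv ℝ ((Q.QB.DA (Q.σ s)).coord ∘ C.B.coneParam) (Q.QB.transition (Q.σ s) (entPoint Q.QB.ε b 0)) :
          E3 →L[ℝ] E3) : E3 →ₗ[ℝ] E3) *
        coneJac φ (Q.QA.transition s (entPoint Q.QA.ε b 0)) *
        LinearMap.det ((fderiv ℝ (Q.QA.transition s) (entPoint Q.QA.ε b 0) : E3 →L[ℝ] E3) : E3 →ₗ[ℝ] E3) := fun b => by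
    rw [← Q.det_fderiv_piMap hkA hkB h₀ hc hφ0 b, Q.det_fderiv_piMap_eq_mul hkA hkB h₀ hc hφ0 b]
  have hA0 : ∀ b : Bool, LinearMap.det ((fderiv ℝ (Q.QA.transition s) (entPoint Q.QA.ε b 0) : E3 →L[ℝ] E3) : E3 →ₗ[ℝ] E3) ≠ 0 :=
    fun b h => by
      have hp := Q.QA.det_fderiv_coord_coneParam_mul (hkA s) b
      rw [h, mul_zero] at hp; exact zero_ne_one hp
  exact pos_iff_pos_of_products (hdet true) (hdet false)
    (Q.QB.det_fderiv_coord_coneParam_mul (hkB _) true) (Q.QB.det_fderiv_coord_coneParam_mul (hkB _) false)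
    (Q.QA.det_fderiv_transition_pos_iff (s := s) (hkA s) o) (Q.QB.det_fderiv_transition_pos_iff (s := Q.σ s) (hkB _) o)
    (coneJac_pos_iff φ (Q.QA.transition_entPoint_zero_mem (hkA s) true).1.1 (Q.QA.transition_entPoint_zero_mem (hkA s) false).1.1)
    (hA0 true) (hA0 false)
    (coneJac_ne_zero φ (Q.QA.transition_entPoint_zero_mem (hkA s) true).1.1)
    (coneJac_ne_zero φ (Q.QA.transition_entPoint_zero_mem (hkA s) false).1.1)

end BasinCouple.SaddleData

end Literature.Topology.FourManifolds
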